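import Mathlib.MeasureTheory.Integral.Bochner.Set
import Mathlib.MeasureTheory.MeasurableSpace.Invariants
import Mathlib.Dynamics.Ergodic.MeasurePreserving
import Mathlib.GroupTheory.Perm.ClosureSwap
import Mathlib.Probability.Kernel.Condexp
import Mathlib.Probability.ProductMeasure
import HarnessLib

/-!
# Exchangeable probability laws on `ℕ → E`: definitions

An infinite random sequence `ξ = (ξ₀, ξ₁, …)` in a measurable space `E` is *exchangeable* when
`(ξ_{k₀}, ξ_{k₁}, …)` has the same law as `ξ` for every finite permutation `(k₀, k₁, …)` of `ℕ`
(Kallenberg, *Foundations of Modern Probability* (2nd ed.), Ch. 11, eq. (6) before Thm 11.10).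
We phrase this for the LAW `P : Measure (ℕ → E)`: `IsExchangeable P` iff `P` is invariant under
`x ↦ x ∘ σ` for every finitely supported permutation `σ` of `ℕ`.

This file holds ALL the definitions of the directory `Literature/Probability/Exchangeability`
(de Finetti's theorem, proved in the sibling files) together with their immediate API:

* `coordPerm σ` — the coordinate permutation `x ↦ x ∘ σ` as a measurable equivalence;
* `IsExchangeable`, `IsExchangeable.of_swap` / `isExchangeable_iff_swap` — it suffices to check
  invariance under the transpositions of two coordinates (finitely supported permutations are
  products of transpositions, Mathlib `mem_closure_isSwap'`);
* `exists_perm_extend` — an injective `κ : Fin k → ℕ` extends to a finitely supported permutation;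
  hence `IsExchangeable.map_sample_eq`, `integral_sample_eq`, `measure_sample_eq`: under an
  exchangeable law, `(x (κ 0), …, x (κ (k-1)))` has the law of `(x 0, …, x (k-1))` (Kallenberg's
  formulation of exchangeability);
* `exchangeableSigmaAlgebra E` — the σ-algebra `ℰ` of events invariant under all transpositions
  of coordinates, with its measurability criterion and the invariance of set integrals over
  `ℰ`-events (`IsExchangeable.setIntegral_comp_swap_eq`);
* `proj n`, `projLE`, `initialCylinders E` — initial-segment projections and cylinders
  (`Marginals.lean` shows they determine finite measures and characterise exchangeability);
* `blockAvg s f` — block averages `|s|⁻¹ ∑_{i ∈ s} f (x i)`, and `limAvg f` — the limsup of the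
  block averages over the first `4^m` coordinates (`BlockAverages.lean`, `LimitStatistic.lean`);
* `apBlock i k n` — the arithmetic-progression block `{i + k j : j < n}` (`DeFinettiProduct.lean`);
* `directingKernel P` — the **directing random measure** `x ↦ P[x 0 ∈ · | ℰ](x)` (a Markov kernel,
  from Mathlib's `condExpKernel`; needs `E` standard Borel), and `iidKernel ν` — the kernel
  `a ↦ (ν a)^{⊗ℕ}` of i.i.d. sequences with random law `ν a` (`DeFinetti.lean`).

## References

* O. Kallenberg, *Foundations of Modern Probability*, 2nd ed., Springer 2002, Ch. 11,
  Thm 11.10 and the definitions preceding it. [Kallenberg2002]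
-/

namespace Literature.Probability.Exchangeability

open _root_.MeasureTheory _root_.ProbabilityTheory Equiv Function Set

variable {E : Type*}

/-! ### Pure (non-measure-theoretic) devices: projections, block averages, blocks -/

/-- The projection of `ℕ → E` onto its first `n` coordinates. [folklore] -/
def proj (n : ℕ) (x : ℕ → E) : Fin n → E := fun i => x i

/-- Unfolding lemma for `proj`. [folklore] -/
@[simp] theorem proj_apply (n : ℕ) (x : ℕ → E) (i : Fin n) : proj n x i = x i := rfl

/-- Restriction from the first `N` to the first `n ≤ N` coordinates. [folklore] -/
def projLE {n N : ℕ} (h : n ≤ N) (y : Fin N → E) : Fin n → E := fun i => y (Fin.castLE h i)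

/-- `projLE h ∘ proj N = proj n`. [folklore] -/
theorem projLE_comp_proj {n N : ℕ} (h : n ≤ N) : projLE (E := E) h ∘ proj N = proj n := rfl

/-- The **block average** of `f` over the coordinates in `s`: `|s|⁻¹ ∑_{i ∈ s} f (x i)`
(`= 0` for `s = ∅`). [folklore] -/
noncomputable def blockAvg (s : Finset ℕ) (f : E → ℝ) (x : ℕ → E) : ℝ :=
  (s.card : ℝ)⁻¹ * ∑ i ∈ s, f (x i)

/-- Unfolding lemma for `blockAvg`. [folklore] -/
theorem blockAvg_def (s : Finset ℕ) (f : E → ℝ) (x : ℕ → E) :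
    blockAvg s f x = (s.card : ℝ)⁻¹ * ∑ i ∈ s, f (x i) := rfl

/-- The **limit statistic** of `f` along the sequence `x`: the `limsup` over `m` of the block
averages of `f` over the first `4^m` coordinates.  (Along an exchangeable law it is the a.s.
LIMIT of these averages and a version of `E[f (x 0) | ℰ]`, see `LimitStatistic.lean`.)
[folklore] -/
noncomputable def limAvg (f : E → ℝ) (x : ℕ → E) : ℝ :=
  Filter.limsup (fun m => blockAvg (Finset.range (4 ^ m)) f x) Filter.atTop

/-- Unfolding lemma for `limAvg`. [folklore] -/
theorem limAvg_def (f : E → ℝ) (x : ℕ → E) :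
    limAvg f x = Filter.limsup (fun m => blockAvg (Finset.range (4 ^ m)) f x) Filter.atTop := rfl

/-- The block `{i + k·j : j < n}` of coordinates (residue class `i mod k`, first `n` members).
[folklore] -/
def apBlock (i k n : ℕ) : Finset ℕ := (Finset.range n).image fun j => i + k * j

variable [MeasurableSpace E]

/-! ### Coordinate permutations and exchangeability -/


/-- Any reindexing `x ↦ x ∘ g` of the coordinates of `ℕ → E` is measurable. [folklore] -/
theorem measurable_comp_right (g : ℕ → ℕ) : Measurable fun x : ℕ → E => x ∘ g :=
  measurable_pi_lambda _ fun i => measurable_pi_apply (g i)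

/-- The coordinate permutation `x ↦ x ∘ σ` of `ℕ → E`, as a measurable equivalence (inverse
`x ↦ x ∘ σ⁻¹`). [folklore] -/
def coordPerm (σ : Perm ℕ) : (ℕ → E) ≃ᵐ (ℕ → E) where
  toFun x := x ∘ σ
  invFun x := x ∘ σ.symm
  left_inv x := by ext i; simp
  right_inv x := by ext i; simp
  measurable_toFun := measurable_comp_right σ
  measurable_invFun := measurable_comp_right σ.symm

/-- `coordPerm σ x = x ∘ σ`. [folklore] -/
@[simp] theorem coordPerm_apply (σ : Perm ℕ) (x : ℕ → E) : coordPerm σ x = x ∘ σ := rfl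

/-- `⇑(coordPerm σ)` is literally `fun x ↦ x ∘ σ`. [folklore] -/
theorem coe_coordPerm (σ : Perm ℕ) : ⇑(coordPerm (E := E) σ) = fun x => x ∘ σ := rfl

/-- **Exchangeability** of a law `P` on `ℕ → E`: invariance under every finitely supported
permutation of the coordinates, i.e. `(ξ_{k₀}, ξ_{k₁}, …) =ᵈ (ξ₀, ξ₁, …)` for every finite
permutation `(k₀, k₁, …)` of `ℕ`. [cite: Kallenberg2002, Ch. 11, eq. (6) before Thm 11.10] -/
def IsExchangeable (P : Measure (ℕ → E)) : Prop :=
  ∀ σ : Perm ℕ, {i | σ i ≠ i}.Finite → P.map (fun x : ℕ → E => x ∘ σ) = P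

/-- A transposition moves only finitely many (at most two) points. [folklore] -/
theorem finite_setOf_swap_ne (i j : ℕ) : {n | swap i j n ≠ n}.Finite := by
  refine (Set.toFinite {i, j}).subset ?_
  intro n hn
  simp only [mem_setOf_eq] at hn
  simp only [mem_insert_iff, mem_singleton_iff]
  by_contra h
  exact hn (swap_apply_of_ne_of_ne (not_or.mp h).1 (not_or.mp h).2)

namespace IsExchangeable

variable {P : Measure (ℕ → E)}

/-- Invariance of an exchangeable law under a finitely supported coordinate permutation, in
`coordPerm` form. [folklore] -/
theorem map_coordPerm (h : IsExchangeable P) {σ : Perm ℕ} (hσ : {i | σ i ≠ i}.Finite) :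
    P.map (coordPerm σ) = P :=
  h σ hσ

/-- A finitely supported coordinate permutation preserves an exchangeable law. [folklore] -/
theorem measurePreserving (h : IsExchangeable P) {σ : Perm ℕ} (hσ : {i | σ i ≠ i}.Finite) :
    MeasurePreserving (coordPerm σ) P P :=
  ⟨(coordPerm σ).measurable, h σ hσ⟩

/-- An exchangeable law is invariant under the transposition of two coordinates. [folklore] -/
theorem map_swap (h : IsExchangeable P) (i j : ℕ) :
    P.map (fun x : ℕ → E => x ∘ swap i j) = P :=
  h _ (finite_setOf_swap_ne i j)

/-- Transposition form of `measurePreserving`. [folklore] -/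
theorem measurePreserving_swap (h : IsExchangeable P) (i j : ℕ) :
    MeasurePreserving (coordPerm (swap i j)) P P :=
  h.measurePreserving (finite_setOf_swap_ne i j)

/-- **Transpositions suffice**: a law invariant under every transposition of two coordinates is
exchangeable (finitely supported permutations are products of transpositions).
[cite: Kallenberg2002, Ch. 11, before Thm 11.10] -/
theorem of_swap (h : ∀ i j : ℕ, P.map (fun x : ℕ → E => x ∘ swap i j) = P) :
    IsExchangeable P := by
  intro σ hσ
  have hmem : σ ∈ Subgroup.closure {τ : Perm ℕ | τ.IsSwap} := by
    rw [mem_closure_isSwap']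
    convert hσ using 1
    ext i
    simp [MulAction.mem_fixedBy, Perm.smul_def]
  refine Subgroup.closure_induction
    (p := fun (τ : Perm ℕ) _ => P.map (fun x : ℕ → E => x ∘ (⇑τ : ℕ → ℕ)) = P) ?_ ?_ ?_ ?_ hmem
  · rintro τ ⟨a, b, -, rfl⟩
    exact h a b
  · simp only [Perm.coe_one, comp_id]
    exact Measure.map_id
  · intro τ₁ τ₂ _ _ h₁ h₂
    have hcomp : (fun x : ℕ → E => x ∘ ⇑(τ₁ * τ₂)) =
        (fun x : ℕ → E => x ∘ τ₂) ∘ (fun x : ℕ → E => x ∘ τ₁) := by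
      funext x; rfl
    rw [hcomp, ← Measure.map_map (measurable_comp_right _) (measurable_comp_right _), h₁, h₂]
  · intro τ _ hτ
    have hcomp : (fun x : ℕ → E => x) =
        (fun x : ℕ → E => x ∘ ⇑(τ⁻¹)) ∘ (fun x : ℕ → E => x ∘ τ) := by
      funext x; ext i; simp
    calc P.map (fun x : ℕ → E => x ∘ ⇑(τ⁻¹))
        = (P.map (fun x : ℕ → E => x ∘ τ)).map (fun x : ℕ → E => x ∘ ⇑(τ⁻¹)) := by rw [hτ]
      _ = P.map (fun x : ℕ → E => x) := by
          rw [Measure.map_map (measurable_comp_right _) (measurable_comp_right _), ← hcomp]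
      _ = P := Measure.map_id

end IsExchangeable

/-- Exchangeability is equivalent to invariance under all transpositions of two coordinates.
[cite: Kallenberg2002, Ch. 11, before Thm 11.10] -/
theorem isExchangeable_iff_swap {P : Measure (ℕ → E)} :
    IsExchangeable P ↔ ∀ i j : ℕ, P.map (fun x : ℕ → E => x ∘ swap i j) = P :=
  ⟨fun h i j => h.map_swap i j, IsExchangeable.of_swap⟩

/-! ### Extending injections to finitely supported permutations -/

/-- A map `κ : ℕ → ℕ` injective on `{0, …, k-1}` agrees there with a finitely supported
permutation of `ℕ`. [folklore] -/
theorem exists_perm_of_injOn (κ : ℕ → ℕ) (k : ℕ) (hκ : InjOn κ (Iio k)) :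
    ∃ σ : Perm ℕ, {i | σ i ≠ i}.Finite ∧ ∀ i < k, σ i = κ i := by
  induction k with
  | zero => exact ⟨1, by simp, fun i hi => absurd hi (Nat.not_lt_zero i)⟩
  | succ k ih =>
    obtain ⟨σ, hσf, hσ⟩ := ih (hκ.mono (Iio_subset_Iio (Nat.le_succ k)))
    refine ⟨σ * swap k (σ.symm (κ k)), ?_, ?_⟩
    · refine (hσf.union (Set.toFinite {k, σ.symm (κ k)})).subset ?_
      intro i hi
      simp only [mem_setOf_eq, Perm.coe_mul, comp_apply] at hi
      by_contra hcon
      simp only [mem_union, mem_setOf_eq, mem_insert_iff, mem_singleton_iff, not_or,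
        not_not] at hcon
      obtain ⟨h1, h2, h3⟩ := hcon
      exact hi (by rw [swap_apply_of_ne_of_ne h2 h3, h1])
    · intro i hi
      rcases Nat.lt_succ_iff_lt_or_eq.mp hi with hlt | rfl
      · have hne1 : i ≠ k := hlt.ne
        have hne2 : i ≠ σ.symm (κ k) := by
          intro heq
          have h1 : σ i = κ k := by rw [heq]; simp
          rw [hσ i hlt] at h1
          have := hκ (mem_Iio.mpr (hlt.trans k.lt_succ_self)) (mem_Iio.mpr k.lt_succ_self) h1
          exact hne1 this
        simp [swap_apply_of_ne_of_ne hne1 hne2, hσ i hlt]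
      · simp
/-- An injective `κ : Fin k → ℕ` agrees with a finitely supported permutation of `ℕ` on
`{0, …, k-1}`. [folklore] -/
theorem exists_perm_extend {k : ℕ} (κ : Fin k → ℕ) (hκ : Injective κ) :
    ∃ σ : Perm ℕ, {i | σ i ≠ i}.Finite ∧ ∀ i : Fin k, σ i = κ i := by
  classical
  let κ' : ℕ → ℕ := fun i => if h : i < k then κ ⟨i, h⟩ else 0
  have hinj : InjOn κ' (Iio k) := by
    intro i hi j hj hij
    have hi' : i < k := mem_Iio.mp hi
    have hj' : j < k := mem_Iio.mp hj
    simp only [κ', hi', hj', dite_true] at hij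
    exact congrArg Fin.val (hκ hij)
  obtain ⟨σ, hσf, hσ⟩ := exists_perm_of_injOn κ' k hinj
  exact ⟨σ, hσf, fun i => by rw [hσ i i.2]; simp [κ', i.2]⟩

namespace IsExchangeable

variable {P : Measure (ℕ → E)}

/-- **Kallenberg's form of exchangeability**: under an exchangeable law, for any `k` DISTINCT
coordinates `κ 0, …, κ (k-1)` the vector `(x (κ i))_{i<k}` has the same law as `(x i)_{i<k}`.
[cite: Kallenberg2002, Ch. 11, eq. (6)] -/
theorem map_sample_eq (h : IsExchangeable P) {k : ℕ} (κ : Fin k → ℕ) (hκ : Injective κ) :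
    P.map (fun (x : ℕ → E) (i : Fin k) => x (κ i)) = P.map (fun (x : ℕ → E) (i : Fin k) => x i) := by
  obtain ⟨σ, hσf, hσ⟩ := exists_perm_extend κ hκ
  have hcomp : (fun (x : ℕ → E) (i : Fin k) => x (κ i)) =
      (fun (x : ℕ → E) (i : Fin k) => x i) ∘ (fun x : ℕ → E => x ∘ σ) := by
    funext x; ext i; simp [hσ i]
  have hmeas : Measurable (fun (x : ℕ → E) (i : Fin k) => x i) :=
    measurable_pi_lambda _ fun i => measurable_pi_apply (i : ℕ)
  rw [hcomp, ← Measure.map_map hmeas (measurable_comp_right _), h σ hσf]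

/-- Integral form of `map_sample_eq` (no measurability of the integrand needed): for distinct
coordinates `κ i`, `∫ F (x (κ 0), …, x (κ (k-1))) dP = ∫ F (x 0, …, x (k-1)) dP`.
[cite: Kallenberg2002, Ch. 11, eq. (6)] -/
theorem integral_sample_eq {G : Type*} [NormedAddCommGroup G] [NormedSpace ℝ G]
    (h : IsExchangeable P) {k : ℕ} (κ : Fin k → ℕ) (hκ : Injective κ) (F : (Fin k → E) → G) :
    ∫ x, F (fun i => x (κ i)) ∂P = ∫ x, F (fun i => x i) ∂P := by
  obtain ⟨σ, hσf, hσ⟩ := exists_perm_extend κ hκ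
  have := (h.measurePreserving hσf).integral_comp' (f := coordPerm σ) (fun x => F fun i => x i)
  simpa [hσ] using this

/-- Whole-space change of variables under a finitely supported coordinate permutation:
`∫ G (x ∘ σ) dP = ∫ G dP`. [folklore] -/
theorem integral_comp_perm_eq {G : Type*} [NormedAddCommGroup G] [NormedSpace ℝ G]
    (h : IsExchangeable P) {σ : Perm ℕ} (hσ : {i | σ i ≠ i}.Finite) (F : (ℕ → E) → G) :
    ∫ x, F (x ∘ σ) ∂P = ∫ x, F x ∂P :=
  (h.measurePreserving hσ).integral_comp' (f := coordPerm σ) F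

/-- Measure form of `map_sample_eq` (no measurability of the set needed): for distinct
coordinates `κ i`, `P {(x (κ i))_i ∈ S} = P {(x i)_{i<k} ∈ S}`.
[cite: Kallenberg2002, Ch. 11, eq. (6)] -/
theorem measure_sample_eq (h : IsExchangeable P) {k : ℕ} (κ : Fin k → ℕ) (hκ : Injective κ)
    (S : Set (Fin k → E)) :
    P {x | (fun i => x (κ i)) ∈ S} = P {x | (fun i : Fin k => x i) ∈ S} := by
  obtain ⟨σ, hσf, hσ⟩ := exists_perm_extend κ hκ
  have hset : {x : ℕ → E | (fun i => x (κ i)) ∈ S} =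
      coordPerm σ ⁻¹' {x | (fun i : Fin k => x i) ∈ S} := by
    ext x; simp [hσ]
  rw [hset, ← MeasurableEquiv.map_apply, h.map_coordPerm hσf]

end IsExchangeable

/-! ### The exchangeable σ-algebra -/

variable (E) in
/-- The **exchangeable σ-algebra** on `ℕ → E`: the (measurable) events invariant under every
transposition of two coordinates — equivalently under every finitely supported permutation of
the coordinates. (Kallenberg works with the shift-invariant σ-field `𝓘_ξ`; any σ-field of a.s.
permutation-invariant events serves to carry the directing random measure.) [folklore] -/
@[implicit_reducible]
def exchangeableSigmaAlgebra : MeasurableSpace (ℕ → E) :=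
  ⨅ p : ℕ × ℕ, MeasurableSpace.invariants (fun x : ℕ → E => x ∘ swap p.1 p.2)

/-- The exchangeable σ-algebra is a sub-σ-algebra of the product σ-algebra. [folklore] -/
theorem exchangeableSigmaAlgebra_le :
    exchangeableSigmaAlgebra E ≤ (inferInstance : MeasurableSpace (ℕ → E)) :=
  (iInf_le _ ((0, 0) : ℕ × ℕ)).trans (MeasurableSpace.invariants_le _)

/-- Membership in the exchangeable σ-algebra: measurable and invariant under every transposition
of coordinates. [folklore] -/
theorem measurableSet_exchangeableSigmaAlgebra_iff {s : Set (ℕ → E)} :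
    MeasurableSet[exchangeableSigmaAlgebra E] s ↔
      MeasurableSet s ∧ ∀ i j : ℕ, (fun x : ℕ → E => x ∘ swap i j) ⁻¹' s = s := by
  simp only [MeasurableSpace.measurableSet_iInf, MeasurableSpace.measurableSet_invariants,
    Prod.forall]
  constructor
  · intro h
    exact ⟨(h 0 0).1, fun i j => (h i j).2⟩
  · rintro ⟨hs, h⟩ i j
    exact ⟨hs, h i j⟩

/-- A measurable function invariant under every transposition of coordinates is measurable for
the exchangeable σ-algebra. [folklore] -/
theorem measurable_exchangeableSigmaAlgebra_of_invariant {β : Type*} [MeasurableSpace β]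
    {g : (ℕ → E) → β} (hg : Measurable g) (hinv : ∀ (i j : ℕ) (x : ℕ → E), g (x ∘ swap i j) = g x) :
    Measurable[exchangeableSigmaAlgebra E] g := by
  intro s hs
  rw [measurableSet_exchangeableSigmaAlgebra_iff]
  refine ⟨hg hs, fun i j => ?_⟩
  ext x
  simp only [Set.mem_preimage, hinv]

/-- Set integrals over an exchangeable event are invariant under transposing two coordinates of
the integrand: `∫_A G (x ∘ swap i j) dP = ∫_A G dP` for `A ∈ ℰ` and `P` exchangeable. [folklore] -/
theorem IsExchangeable.setIntegral_comp_swap_eq {G : Type*} [NormedAddCommGroup G]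
    [NormedSpace ℝ G] {P : Measure (ℕ → E)} (h : IsExchangeable P) {A : Set (ℕ → E)}
    (hA : MeasurableSet[exchangeableSigmaAlgebra E] A) (i j : ℕ) (F : (ℕ → E) → G) :
    ∫ x in A, F (x ∘ swap i j) ∂P = ∫ x in A, F x ∂P := by
  rw [measurableSet_exchangeableSigmaAlgebra_iff] at hA
  have hpre : coordPerm (E := E) (swap i j) ⁻¹' A = A := hA.2 i j
  have := (h.measurePreserving_swap i j).setIntegral_preimage_emb
    (coordPerm (swap i j)).measurableEmbedding F A
  rw [hpre] at this
  simpa using this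

/-- In particular `∫_A f (x i) dP = ∫_A f (x 0) dP` for every coordinate `i`, every `A` in the
exchangeable σ-algebra and every exchangeable `P`. [folklore] -/
theorem IsExchangeable.setIntegral_eval_eq {G : Type*} [NormedAddCommGroup G]
    [NormedSpace ℝ G] {P : Measure (ℕ → E)} (h : IsExchangeable P) {A : Set (ℕ → E)}
    (hA : MeasurableSet[exchangeableSigmaAlgebra E] A) (f : E → G) (i : ℕ) :
    ∫ x in A, f (x i) ∂P = ∫ x in A, f (x 0) ∂P := by
  have := h.setIntegral_comp_swap_eq hA 0 i (fun x => f (x 0))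
  simpa using this


/-! ### Measurability of the devices; initial cylinders -/

/-- The initial-segment projections are measurable. [folklore] -/
@[fun_prop]
theorem measurable_proj (n : ℕ) : Measurable (proj (E := E) n) :=
  measurable_pi_lambda _ fun i => measurable_pi_apply (i : ℕ)

/-- `projLE` is measurable. [folklore] -/
@[fun_prop]
theorem measurable_projLE {n N : ℕ} (h : n ≤ N) : Measurable (projLE (E := E) h) :=
  measurable_pi_lambda _ fun _ => measurable_pi_apply _

variable (E) in
/-- The **initial cylinders**: preimages under `proj n` of measurable subsets of `Fin n → E`.
[folklore] -/
def initialCylinders : Set (Set (ℕ → E)) :=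
  {S | ∃ (n : ℕ) (A : Set (Fin n → E)), MeasurableSet A ∧ S = proj n ⁻¹' A}

/-- Initial cylinders are measurable. [folklore] -/
theorem measurableSet_of_mem_initialCylinders {S : Set (ℕ → E)} (hS : S ∈ initialCylinders E) :
    MeasurableSet S := by
  obtain ⟨n, A, hA, rfl⟩ := hS
  exact measurable_proj n hA

/-- Block averages of a measurable function are measurable. [folklore] -/
@[fun_prop]
theorem measurable_blockAvg (s : Finset ℕ) {f : E → ℝ} (hf : Measurable f) :
    Measurable (blockAvg s f) := by
  unfold blockAvg
  exact measurable_const.mul (Finset.measurable_sum _ fun i _ => hf.comp (measurable_pi_apply i))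

/-- The limit statistic of a measurable `f` is measurable. [folklore] -/
@[fun_prop]
theorem measurable_limAvg {f : E → ℝ} (hf : Measurable f) : Measurable (limAvg f) :=
  Measurable.limsup fun m => measurable_blockAvg (Finset.range (4 ^ m)) hf

/-! ### The directing kernel and the i.i.d. kernel -/

section Directing

variable [StandardBorelSpace E]

/-- The **directing random measure** of a law `P` on `ℕ → E` (`E` standard Borel): the Markov
kernel `x ↦ ν_x := P[x 0 ∈ · | ℰ](x)`, a regular version of the conditional law of the first
coordinate given the exchangeable σ-algebra (Mathlib's `condExpKernel`, pushed forward along the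
first coordinate).  For exchangeable `P` this is Kallenberg's `η = P[ξ₁ ∈ · | 𝓘_ξ]` up to the
choice of the conditioning σ-field: both are a.s. the limit of the empirical distributions
(`DeFinetti.lean`, `IsExchangeable.ae_tendsto_empirical`). [cite: Kallenberg2002, Thm 11.10] -/
noncomputable def directingKernel (P : Measure (ℕ → E)) [IsFiniteMeasure P] :
    Kernel (ℕ → E) E where
  toFun x := ((condExpKernel P (exchangeableSigmaAlgebra E)) x).map (fun y : ℕ → E => y 0)
  measurable' := (Measure.measurable_map _ (measurable_pi_apply 0)).comp
    ((condExpKernel P (exchangeableSigmaAlgebra E)).measurable.mono exchangeableSigmaAlgebra_le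
      le_rfl)

variable (P : Measure (ℕ → E))

/-- Pointwise description of the directing kernel. [folklore] -/
theorem directingKernel_apply [IsFiniteMeasure P] (x : ℕ → E) :
    directingKernel P x =
      ((condExpKernel P (exchangeableSigmaAlgebra E)) x).map (fun y : ℕ → E => y 0) := rfl

/-- The directing kernel is a Markov kernel (random PROBABILITY measure). [folklore] -/
instance isMarkovKernel_directingKernel [IsFiniteMeasure P] :
    IsMarkovKernel (directingKernel P) :=
  ⟨fun x => by
    rw [directingKernel_apply]
    exact Measure.isProbabilityMeasure_map (measurable_pi_apply 0).aemeasurable⟩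

/-- Integrating against the directing kernel = integrating `f (y 0)` against the conditional
kernel. [folklore] -/
theorem integral_directingKernel [IsFiniteMeasure P] (x : ℕ → E) {f : E → ℝ}
    (hf : Measurable f) :
    ∫ z, f z ∂(directingKernel P x) =
      ∫ y, f (y 0) ∂((condExpKernel P (exchangeableSigmaAlgebra E)) x) := by
  rw [directingKernel_apply, integral_map (measurable_pi_apply 0).aemeasurable
    hf.aestronglyMeasurable]

end Directing

section IID

variable {α : Type*} [MeasurableSpace α]

/-- The kernel `a ↦ (ν a)^{⊗ℕ}` of i.i.d. sequences with the random law `ν a` (Mathlib's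
`Measure.infinitePi`; measurability in `a` is checked on square cylinders). [folklore] -/
noncomputable def iidKernel (ν : Kernel α E) [IsMarkovKernel ν] : Kernel α (ℕ → E) where
  toFun a := Measure.infinitePi fun _ : ℕ => ν a
  measurable' := by
    refine Measurable.measure_of_isPiSystem_of_isProbabilityMeasure
      generateFrom_squareCylinders.symm
      (isPiSystem_squareCylinders (fun _ => MeasurableSpace.isPiSystem_measurableSet)
        fun _ => MeasurableSet.univ) ?_
    rintro _ ⟨s, t, ht, rfl⟩
    simp only [Set.mem_univ_pi, Set.mem_setOf_eq] at ht
    have : (fun a => Measure.infinitePi (fun _ : ℕ => ν a) ((s : Set ℕ).pi t)) =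
        fun a => ∏ i ∈ s, ν a (t i) :=
      funext fun a => Measure.infinitePi_pi _ fun i _ => ht i
    rw [this]
    exact Finset.measurable_prod _ fun i _ => ν.measurable_coe (ht i)

/-- Pointwise description of `iidKernel`. [folklore] -/
theorem iidKernel_apply (ν : Kernel α E) [IsMarkovKernel ν] (a : α) :
    iidKernel ν a = Measure.infinitePi fun _ : ℕ => ν a := rfl

/-- `iidKernel ν` is a Markov kernel. [folklore] -/
instance isMarkovKernel_iidKernel (ν : Kernel α E) [IsMarkovKernel ν] :
    IsMarkovKernel (iidKernel ν) :=
  ⟨fun a => by rw [iidKernel_apply]; infer_instance⟩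

end IID

end Literature.Probability.Exchangeability
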